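import Summits.PneNP.PneNP.Theses.PhaseTwins

/-!
# `PolyDepthTwinsAbove` (stmt-PneNP-2719), negative side I: load-bearing hypotheses

Support file of the crux disprover (cdisprove seat `refuter-cdisprove-stmt-PneNP-2719-0`) for
`PhaseTwins.PolyDepthTwinsAbove` (self-contained copy of §1 of the crux work file
`Cruxes/PolyDepthTwinsAbove/Disproof.lean`). Two degenerate-instance facts recording which hypotheses of
the crux cannot simply be deleted (the mutated statements are written INLINE in the theorem types — they
are the crux `PhaseTwins.PolyDepthTwinsAbove` with exactly one hypothesis removed):

* `polyDepthTwinsAbove_false_without_threshold` — with the activity hypothesis `λ_c(Δ) < λ` dropped the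
  statement fails at `λ = 0` (`Z_G(0) = 1` for every graph, so no factor-2 gap);
* `polyDepthTwinsAbove_false_without_degreeLB` — with `3 ≤ Δ` dropped it fails at `Δ = 0`, where Lean's
  value of the threshold formula `(Δ-1)^{Δ-1}/(Δ-2)^Δ` is the junk `1` and graphs of maximum degree `0` are
  edgeless (`Z_G = Z_H = 3^n` at `λ = 2`).

Neither touches the substance of the crux (work-file verdict: a refutation would be a positive
approximation theorem above `λ_c`, and would contradict Sly 2010 Thm 2.1 through the line
`parity-wired-ports`). [folklore]
-/

set_option linter.dupNamespace false

namespace Summit.PneNP.PneNP.Theorems.PolyDepthTwinsAbove.Negative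

open scoped BigOperators Classical

/-- At activity `0` only the empty set counts: the crux's inlined hard-core sum is `Z_G(0) = 1`. -/
theorem indepSum_zero {n : ℕ} (G : SimpleGraph (Fin n)) :
    (∑ I : Finset (Fin n), (if G.IsIndepSet (↑I : Set (Fin n)) then (0 : ℝ) ^ I.card else 0)) = 1 := by
  rw [Finset.sum_eq_single (∅ : Finset (Fin n))]
  · have h : G.IsIndepSet ((∅ : Finset (Fin n)) : Set (Fin n)) := by
      simp [SimpleGraph.IsIndepSet, Set.Pairwise]
    simp
  · intro I _ hI
    have hc : I.card ≠ 0 := by rwa [Ne, Finset.card_eq_zero]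
    simp [zero_pow hc]
  · intro h; exact absurd (Finset.mem_univ _) h

/-- **Any proof of the crux must use `λ > λ_c(Δ)`, at least to exclude `λ = 0`.** The statement inside the
negation is `PhaseTwins.PolyDepthTwinsAbove` with the hypothesis `(Δ-1)^(Δ-1)/(Δ-2)^Δ < lam` deleted; it is
false at `Δ = 3, λ = 0`: `Z_G(0) = Z_H(0) = 1`, so `2·Z_H ≤ Z_G` fails for every pair `G, H`. (The honest
weakening `0 < λ` is expected to be false below `λ_c(Δ)` by the route's support `LogDepthContinuityBelow`;
not attempted here.) -/
theorem polyDepthTwinsAbove_false_without_threshold :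
    ¬ (∀ Δ : ℕ, 3 ≤ Δ → ∀ lam : ℝ, ∃ θ : ℝ, 0 < θ ∧ ∀ n₀ : ℕ, ∃ (n : ℕ) (G H : SimpleGraph (Fin n)),
      n₀ ≤ n ∧ G.maxDegree ≤ Δ ∧ H.maxDegree ≤ Δ ∧
      (∀ (m : ℕ) (F : SimpleGraph (Fin m)),
        (Literature.Combinatorics.SimpleGraph.treewidth F : ℝ) < (n : ℝ) ^ θ →
          Nat.card (F →g G) = Nat.card (F →g H)) ∧
      2 * (∑ I : Finset (Fin n), (if H.IsIndepSet (↑I : Set (Fin n)) then lam ^ I.card else 0)) ≤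
        ∑ I : Finset (Fin n), (if G.IsIndepSet (↑I : Set (Fin n)) then lam ^ I.card else 0)) := by
  intro h
  obtain ⟨θ, -, hn⟩ := h 3 le_rfl 0
  obtain ⟨n, G, H, -, -, -, -, hZ⟩ := hn 0
  rw [indepSum_zero G, indepSum_zero H] at hZ
  norm_num at hZ

/-- In a graph of maximum degree `0` every vertex set is independent. -/
theorem isIndepSet_of_maxDegree_le_zero {n : ℕ} (G : SimpleGraph (Fin n)) (h : G.maxDegree ≤ 0)
    (S : Set (Fin n)) : G.IsIndepSet S := by
  intro v _ w _ _ hvw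
  have h1 : 0 < G.degree v := by
    rw [← SimpleGraph.card_neighborFinset_eq_degree, Finset.card_pos]
    exact ⟨w, (SimpleGraph.mem_neighborFinset G v w).2 hvw⟩
  have h2 : G.degree v ≤ G.maxDegree := SimpleGraph.degree_le_maxDegree G v
  omega

/-- **The threshold formula is junk below `Δ = 3`, so `3 ≤ Δ` cannot simply be dropped.** The statement
inside the negation is `PhaseTwins.PolyDepthTwinsAbove` with the hypothesis `3 ≤ Δ` deleted. At `Δ = 0`
Lean evaluates `(Δ-1)^{Δ-1}/(Δ-2)^Δ = (-1)^0/(-2)^0 = 1`; for `λ = 2 > 1` a graph of maximum degree `0` is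
edgeless, so `Z_G(2) = Z_H(2) = 3^n > 0` and the factor-2 gap is impossible. (At `Δ = 2` the formula gives
`1/0 = 0`; there the statement is false for the honest reason that unions of paths and cycles are determined
up to isomorphism by hom counts of treewidth `≤ 2`; not attempted.) -/
theorem polyDepthTwinsAbove_false_without_degreeLB :
    ¬ (∀ Δ : ℕ, ∀ lam : ℝ, ((Δ : ℝ) - 1) ^ (Δ - 1) / ((Δ : ℝ) - 2) ^ Δ < lam → ∃ θ : ℝ, 0 < θ ∧
      ∀ n₀ : ℕ, ∃ (n : ℕ) (G H : SimpleGraph (Fin n)),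
      n₀ ≤ n ∧ G.maxDegree ≤ Δ ∧ H.maxDegree ≤ Δ ∧
      (∀ (m : ℕ) (F : SimpleGraph (Fin m)),
        (Literature.Combinatorics.SimpleGraph.treewidth F : ℝ) < (n : ℝ) ^ θ →
          Nat.card (F →g G) = Nat.card (F →g H)) ∧
      2 * (∑ I : Finset (Fin n), (if H.IsIndepSet (↑I : Set (Fin n)) then lam ^ I.card else 0)) ≤
        ∑ I : Finset (Fin n), (if G.IsIndepSet (↑I : Set (Fin n)) then lam ^ I.card else 0)) := by
  intro h
  obtain ⟨θ, -, hn⟩ := h 0 2 (by norm_num)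
  obtain ⟨n, G, H, -, hG, hH, -, hZ⟩ := hn 0
  have hGe : ∀ I : Finset (Fin n), G.IsIndepSet (↑I : Set (Fin n)) :=
    fun I => isIndepSet_of_maxDegree_le_zero G hG _
  have hHe : ∀ I : Finset (Fin n), H.IsIndepSet (↑I : Set (Fin n)) :=
    fun I => isIndepSet_of_maxDegree_le_zero H hH _
  simp only [hGe, hHe, if_true] at hZ
  have hpos : 0 < ∑ I : Finset (Fin n), (2 : ℝ) ^ I.card :=
    Finset.sum_pos (fun I _ => by positivity) Finset.univ_nonempty
  linarith

end Summit.PneNP.PneNP.Theorems.PolyDepthTwinsAbove.Negative
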